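import Summits.ValiantsHypothesis.ValiantsHypothesis.Theorems.NcUnbalancedRank
import HarnessLib

/-!
# The unbalance dial for the permanent: `PERM_n` against `δ`-unbalanced noncommutative circuits

Workshop file for the node `CommutativityDial` (decomp-valiant lens 6 «restricted-models lifting axis»;
offer O-L6-13 «THE UNBALANCE DIAL», FILE 3 of 3; FILE 1 = `NcUnbalancedStructure`, FILE 2 =
`NcUnbalancedRank`). Limaye–Malod–Srinivasan (ToC 12 (2016), Def. 5.6 / Cor. 5.7, §7): the
skew-circuit lower bound for the permanent survives for `δ`-unbalanced circuits with a loss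
`n^{O(δ)}`. Along HWY's lifting substitution `PERM_n ↦ LID_r` (`perm_lift`, `4r ≤ n`) the
per-gate hypothesis to transport is Def. 5.6 READ SEMANTICALLY (`δ = w + 1`): «at every product gate
one operand's VALUE has degree `≤ w + 1`» — all its components of degrees `w + 2 ≤ b ≤ d + 1` vanish.

* §1 TRANSPORT: an input substitution `x ↦ letter | scalar` (`FreeAlgebra.lift` of `ncInputVal ∘ φ`)
  maps a word of length `c` to a scalar multiple of a word of length `≤ c` (`lift_word_eq_smul`), so it
  does not raise degrees: «all components of degrees `t ≤ b ≤ d + 1` vanish» is preserved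
  (`high_degPart_lift`). (FILE 1's weaker capped hypothesis «components of degrees `b, b' ≥ w + 2`,
  `b + b' ≤ d`, multiply to zero» is NOT preserved — `u = u' = x_1 ⋯ x_d` is vacuously fine, but after
  half the letters go to `1` the two degree-`d/2` values multiply to a nonzero word — which is why the
  permanent is stated under the degree form.)
* §2 `degree_substIn`: the semantic Def. 5.6 passes from `P.gates` to `(P.substIn φ).gates`.
* §3 **`PERM_n` against `δ`-unbalanced circuits** (`ncPerPoly_unbalanced`): every fan-in-two
  noncommutative circuit computing the ordered `n × n` permanent, `4r ≤ n`, `r ≥ 1`, satisfying the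
  semantic Def. 5.6 with `δ = w + 1` up to degree `4r`, has **`2^r ≤ (r+1) · (w+1) 2^w · size`**;
  `w = 0` contains the skew circuits (`NcSkewPermanent.ncPerPoly_skew`); §4 the same in the binder
  shape of `PerNotNcVP` restricted to such circuits (`perNotNcUnbVP`), for every FIXED `w`.

HONEST FRAMING: LMS16 Cor. 5.7 + §7 with HWY10 Lemma C.5, explicit constants, new in the kernel only;
for `w` growing like `n` the class exhausts all fan-in-two circuits (FILE 1 `unbalanced_of_lt`) and
the bound says nothing — the open general case `A_nc` (item 23446) and `VP ≠ VNP` are untouched.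
-/

noncomputable section

namespace Summit.ValiantsHypothesis.ValiantsHypothesis.Theorems.NcUnbalancedPermanent

open Literature.Computability.AlgebraicComplexity Literature.Computability.AlgebraicComplexity.ArithCircuit
open Summit.ValiantsHypothesis.ValiantsHypothesis.Theorems.NcAutomatonIntersection
  Summit.ValiantsHypothesis.ValiantsHypothesis.Theorems.NcCentralWidth
  Summit.ValiantsHypothesis.ValiantsHypothesis.Theorems.NcSOSDegreeFour
  Summit.ValiantsHypothesis.ValiantsHypothesis.Theorems.NcBlockForms
  Summit.ValiantsHypothesis.ValiantsHypothesis.Theorems.NcCayleyDeterminant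
  Summit.ValiantsHypothesis.ValiantsHypothesis.Theorems.NcSOSPermanent
  Summit.ValiantsHypothesis.ValiantsHypothesis.Theorems.NcSkewStructure
  Summit.ValiantsHypothesis.ValiantsHypothesis.Theorems.NcSkewPermanent
  Summit.ValiantsHypothesis.ValiantsHypothesis.Theorems.NcUnbalancedStructure
  Summit.ValiantsHypothesis.ValiantsHypothesis.Theorems.NcUnbalancedRank

universe u v v'

/-! ## §1 Input substitutions do not raise degrees -/

section Transport

variable {R : Type u} [CommSemiring R] {σ : Type v} {τ : Type v'}

/-- An input substitution maps a word of length `c` to a SCALAR MULTIPLE OF A WORD of length `≤ c`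
(letters that go to scalars shorten the word). [cite: Burgisser2000, Rem. 2.2] -/
theorem lift_word_eq_smul (φ : σ → τ ⊕ R) (u : List σ) :
    ∃ (c : R) (u' : List τ), u'.length ≤ u.length ∧
      FreeAlgebra.lift R (fun i => ncInputVal (φ i)) ((u.map (FreeAlgebra.ι R)).prod) =
        c • (u'.map (FreeAlgebra.ι R)).prod := by
  induction u with
  | nil => exact ⟨1, [], le_rfl, by simp⟩
  | cons x u ih =>
    obtain ⟨c, u', hu', h⟩ := ih
    simp only [List.map_cons, List.prod_cons, map_mul, FreeAlgebra.lift_ι_apply]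
    rw [h]
    cases φ x with
    | inl j =>
      exact ⟨c, j :: u', by simp only [List.length_cons]; omega,
        by rw [List.map_cons, List.prod_cons, mul_smul_comm]; rfl⟩
    | inr a =>
      exact ⟨a * c, u', by simp only [List.length_cons]; omega,
        by rw [show ncInputVal (Sum.inr a : τ ⊕ R) = algebraMap R (FreeAlgebra R τ) a from rfl,
          Algebra.algebraMap_eq_smul_one, smul_mul_assoc, one_mul, smul_smul]⟩

/-- The image of a degree-`c` component (`c ≤ d`) has no component at any index `c < b ≤ d + 1`.
[cite: LimayeMalodSrinivasan2016, Def. 5.6] -/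
theorem degPart_lift_degPart (φ : σ → τ ⊕ R) {d c b : ℕ} (hc : c ≤ d) (hcb : c < b)
    (hb : b ≤ d + 1) (f : FreeAlgebra R σ) :
    degPart d b (FreeAlgebra.lift R (fun i => ncInputVal (φ i)) (degPart d c f)) = 0 := by
  induction f using word_induction with
  | h0 => simp only [map_zero]
  | hadd f g hf hg => rw [map_add, map_add, map_add, hf, hg, add_zero]
  | hw r u =>
    obtain ⟨c', u', hu', h⟩ := lift_word_eq_smul φ u
    rw [map_smul, degPart_word']
    split_ifs with hu
    · rw [map_smul, h, map_smul, map_smul, degPart_word', if_neg, smul_zero, smul_zero]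
      omega
    · rw [smul_zero, map_zero, map_zero]

/-- **TRANSPORT**: if all components of `f` of degrees `t ≤ b ≤ d + 1` vanish («`f` has degree
`< t`»), the same holds for its image under an input substitution. [cite: LimayeMalodSrinivasan2016, Def. 5.6] -/
theorem high_degPart_lift (φ : σ → τ ⊕ R) {d t : ℕ} {f : FreeAlgebra R σ}
    (hf : ∀ b : ℕ, t ≤ b → b ≤ d + 1 → degPart d b f = 0) :
    ∀ b : ℕ, t ≤ b → b ≤ d + 1 →
      degPart d b (FreeAlgebra.lift R (fun i => ncInputVal (φ i)) f) = 0 := by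
  classical
  intro b hb hbd
  have key : ∀ a : Fin (d + 2), degPart d a.1 f = dfaProj (cnt d) ⟨0, by omega⟩ a f := fun a => by
    unfold degPart
    rw [show (⟨min a.1 (d + 1), by omega⟩ : Fin (d + 2)) = a from
      Fin.ext (Nat.min_eq_left (by omega))]
  have hsum : ∑ a : Fin (d + 2), degPart d a.1 f = f := by
    simp only [key]; exact sum_dfaProj (cnt d) f ⟨0, by omega⟩
  rw [← hsum, map_sum, map_sum]
  refine Finset.sum_eq_zero fun a _ => ?_
  by_cases hta : t ≤ a.1
  · rw [hf a.1 hta (by omega), map_zero, map_zero]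
  · exact degPart_lift_degPart φ (by omega) (by omega) hbd f

end Transport

/-! ## §2 The semantic Def. 5.6 under input substitution -/

section SubstIn

variable {R : Type u} [CommSemiring R] {σ : Type v} {τ : Type v'}

/-- **Def. 5.6 (semantic, `δ = w + 1`) survives input substitution**: the gates of `P.substIn φ` are
the substituted gates, their values the images of the values (`ncGateValues_substIn`), and images do
not raise degrees (§1). [cite: LimayeMalodSrinivasan2016, Def. 5.6, §7] -/
theorem degree_substIn (φ : σ → τ ⊕ R) (gs : List (Gate R σ)) {d w : ℕ}
    (hdeg : ∀ (l₁ : List (Gate R σ)) (o o' : Operand R σ) (l₂ : List (Gate R σ)),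
      gs = l₁ ++ Gate.prod [o, o'] :: l₂ →
        (∀ b : ℕ, w + 2 ≤ b → b ≤ d + 1 → degPart d b (o.ncEval (ncGateValues l₁)) = 0) ∨
        (∀ b : ℕ, w + 2 ≤ b → b ≤ d + 1 → degPart d b (o'.ncEval (ncGateValues l₁)) = 0)) :
    ∀ (l₁ : List (Gate R τ)) (o o' : Operand R τ) (l₂ : List (Gate R τ)),
      gs.map (Gate.substIn φ) = l₁ ++ Gate.prod [o, o'] :: l₂ →
        (∀ b : ℕ, w + 2 ≤ b → b ≤ d + 1 → degPart d b (o.ncEval (ncGateValues l₁)) = 0) ∨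
        (∀ b : ℕ, w + 2 ≤ b → b ≤ d + 1 → degPart d b (o'.ncEval (ncGateValues l₁)) = 0) := by
  intro l₁ o o' l₂ h
  obtain ⟨m₁, m₂, rfl, hm₁, hm₂⟩ := List.map_eq_append_iff.1 h
  obtain ⟨g, m₃, rfl, hg, rfl⟩ := List.map_eq_cons_iff.1 hm₂
  subst hm₁
  cases g with
  | sum args => simp [Gate.substIn] at hg
  | prod args =>
    simp only [Gate.substIn, Gate.prod.injEq, List.map_eq_cons_iff, List.map_eq_nil_iff] at hg
    obtain ⟨u, rest, rfl, rfl, u', rest', rfl, rfl, rfl⟩ := hg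
    rw [ncGateValues_substIn, operand_ncEval_substIn, operand_ncEval_substIn]
    rcases hdeg m₁ u u' m₃ rfl with hu | hu
    · exact Or.inl (high_degPart_lift φ hu)
    · exact Or.inr (high_degPart_lift φ hu)

end SubstIn

/-! ## §3 The permanent -/

section Perm

variable (K : Type u) [Field K]

/-- **THE ORDERED PERMANENT IS EXPONENTIALLY HARD FOR `δ`-UNBALANCED CIRCUITS** (LMS16 Cor. 5.7 +
§7 via HWY's Lemma C.5, explicit): every fan-in-two noncommutative circuit computing `PERM_n`,
`4r ≤ n`, `r ≥ 1`, in which at every product gate one operand's value has degree `≤ w + 1` (all its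
components of degrees `w + 2 ≤ b ≤ 4r + 1` vanish), has **`2^r ≤ (r+1) · (w+1) 2^w · size`**.
[cite: LimayeMalodSrinivasan2016, Cor. 5.7, §7] -/
theorem ncPerPoly_unbalanced {r n w : ℕ} (hr : 1 ≤ r) (hn : 4 * r ≤ n)
    (P : ArithCircuit K (Fin n × Fin n)) (h2 : P.IsFanInTwo)
    (hdeg : ∀ (l₁ : List (Gate K (Fin n × Fin n))) (o o' : Operand K (Fin n × Fin n))
        (l₂ : List (Gate K (Fin n × Fin n))), P.gates = l₁ ++ Gate.prod [o, o'] :: l₂ →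
      (∀ b : ℕ, w + 2 ≤ b → b ≤ 4 * r + 1 → degPart (4 * r) b (o.ncEval (ncGateValues l₁)) = 0) ∨
      (∀ b : ℕ, w + 2 ≤ b → b ≤ 4 * r + 1 → degPart (4 * r) b (o'.ncEval (ncGateValues l₁)) = 0))
    (h : P.ncEval = ncPerPoly K n) : 2 ^ r ≤ (r + 1) * ((w + 1) * 2 ^ w) * P.size := by
  have hQ : (P.substIn (liftSubst K r n)).ncEval = lidPoly K r := by
    rw [ncEval_substIn, h, perm_lift K hn]
  have := lidPoly_degree K hr (P.substIn (liftSubst K r n)) (h2.substIn _)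
    (degree_substIn (liftSubst K r n) P.gates hdeg) hQ
  rwa [size_substIn] at this

/-- The same with `r = ⌊n/4⌋` (hypothesis up to degree `4⌊n/4⌋`): `2^{⌊n/4⌋} ≤ (⌊n/4⌋+1)(w+1)2^w · size`,
every `n ≥ 4`. [cite: LimayeMalodSrinivasan2016, Cor. 5.7, §7] -/
theorem ncPerPoly_unbalanced_floor {n w : ℕ} (hn : 4 ≤ n) (P : ArithCircuit K (Fin n × Fin n))
    (h2 : P.IsFanInTwo)
    (hdeg : ∀ (l₁ : List (Gate K (Fin n × Fin n))) (o o' : Operand K (Fin n × Fin n))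
        (l₂ : List (Gate K (Fin n × Fin n))), P.gates = l₁ ++ Gate.prod [o, o'] :: l₂ →
      (∀ b : ℕ, w + 2 ≤ b → b ≤ 4 * (n / 4) + 1 →
        degPart (4 * (n / 4)) b (o.ncEval (ncGateValues l₁)) = 0) ∨
      (∀ b : ℕ, w + 2 ≤ b → b ≤ 4 * (n / 4) + 1 →
        degPart (4 * (n / 4)) b (o'.ncEval (ncGateValues l₁)) = 0))
    (h : P.ncEval = ncPerPoly K n) : 2 ^ (n / 4) ≤ (n / 4 + 1) * ((w + 1) * 2 ^ w) * P.size :=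
  ncPerPoly_unbalanced K (r := n / 4) (by omega) (Nat.mul_div_le n 4) P h2 hdeg h

end Perm

/-! ## §4 The binder shape of `PerNotNcVP`, restricted to `δ`-unbalanced circuits -/

/-- Growth bookkeeping: `(m+1)·(w+1)2^w·((4m)^c + c) < 2^m` for some `m ≥ 1` (the `m` of
`NcSkewPermanent.skew_growth (c + w + 2)`). [cite: LimayeMalodSrinivasan2016, §7] -/
theorem unb_growth (c w : ℕ) :
    ∃ m : ℕ, 1 ≤ m ∧ (m + 1) * ((w + 1) * 2 ^ w) * ((4 * m) ^ c + c) < 2 ^ m := by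
  obtain ⟨m, hm, hlt⟩ := skew_growth (c + w + 2)
  refine ⟨m, hm, lt_of_le_of_lt ?_ hlt⟩
  have hw1 : (w + 1) * 2 ^ w ≤ (4 * m) ^ (w + 1) :=
    calc (w + 1) * 2 ^ w ≤ 2 ^ w * 2 ^ w :=
          Nat.mul_le_mul_right _ (Nat.lt_two_pow_self : w + 1 ≤ 2 ^ w)
      _ = 4 ^ w := (four_pow_eq_mul w).symm
      _ ≤ (4 * m) ^ w := Nat.pow_le_pow_left (by omega) w
      _ ≤ (4 * m) ^ (w + 1) := Nat.pow_le_pow_right (by omega) (by omega)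
  have hc : c ≤ (4 * m) ^ c :=
    (Nat.lt_two_pow_self : c < 2 ^ c).le.trans (Nat.pow_le_pow_left (by omega) c)
  have hX : (4 * m) ^ (w + 1) * c ≤ (4 * m) ^ (c + w + 1) :=
    calc (4 * m) ^ (w + 1) * c ≤ (4 * m) ^ (w + 1) * (4 * m) ^ c := Nat.mul_le_mul_left _ hc
      _ = (4 * m) ^ (c + w + 1) := by rw [← pow_add, show w + 1 + c = c + w + 1 by omega]
  rw [mul_assoc]
  apply Nat.mul_le_mul_left
  calc (w + 1) * 2 ^ w * ((4 * m) ^ c + c)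
      ≤ (4 * m) ^ (w + 1) * ((4 * m) ^ c + c) := Nat.mul_le_mul_right _ hw1
    _ = (4 * m) ^ (c + w + 1) + (4 * m) ^ (w + 1) * c := by
        rw [mul_add, ← pow_add, show w + 1 + c = c + w + 1 by omega]
    _ ≤ (4 * m) ^ (c + w + 1) + (4 * m) ^ (c + w + 1) := by omega
    _ ≤ 4 * m * (4 * m) ^ (c + w + 1) := by
        rw [← two_mul]; exact Nat.mul_le_mul_right _ (by omega)
    _ = (4 * m) ^ (c + w + 2) := by ring
    _ ≤ (4 * m) ^ (c + w + 2) + (c + w + 2) := Nat.le_add_right _ _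

/-- (ε) **The i.o. rung in the binder shape of `PerNotNcVP`, for `δ`-UNBALANCED circuits** (every
fixed window `w`, `δ = w + 1`): for every `c` some ordered `n × n` permanent needs fan-in-two
noncommutative circuits of size `> n^c + c` among those in which every product gate has an operand
whose value has degree `≤ w + 1` (semantically, up to degree `n`). Says nothing about circuits with
a product gate both of whose operands have degree `≥ w + 2`. [cite: LimayeMalodSrinivasan2016, Cor. 5.7, §7] -/
theorem perNotNcUnbVP (c w : ℕ) : ∃ n : ℕ, ∀ P : ArithCircuit ℂ (Fin n × Fin n), P.IsFanInTwo →
    (∀ (l₁ : List (Gate ℂ (Fin n × Fin n))) (o o' : Operand ℂ (Fin n × Fin n))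
        (l₂ : List (Gate ℂ (Fin n × Fin n))), P.gates = l₁ ++ Gate.prod [o, o'] :: l₂ →
      (∀ b : ℕ, w + 2 ≤ b → b ≤ n + 1 → degPart n b (o.ncEval (ncGateValues l₁)) = 0) ∨
      (∀ b : ℕ, w + 2 ≤ b → b ≤ n + 1 → degPart n b (o'.ncEval (ncGateValues l₁)) = 0)) →
    P.ncEval = ncPerPoly ℂ n → n ^ c + c < P.size := by
  obtain ⟨m, hm, hlt⟩ := unb_growth c w
  refine ⟨4 * m, fun P h2 hdeg h => ?_⟩
  have hle := ncPerPoly_unbalanced ℂ hm le_rfl P h2 hdeg h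
  by_contra hcon
  have := Nat.mul_le_mul_left ((m + 1) * ((w + 1) * 2 ^ w)) (Nat.not_lt.1 hcon)
  omega

end Summit.ValiantsHypothesis.ValiantsHypothesis.Theorems.NcUnbalancedPermanent

end
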